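import Literature.MathematicalPhysics.QuantumFieldTheory.Balaban1983to89.Beta.SecondOrderResponse
import Literature.MathematicalPhysics.QuantumFieldTheory.Balaban1983to89.Beta.HessKerRate
import Literature.MathematicalPhysics.QuantumFieldTheory.Balaban1983to89.Beta.StepJetData

/-!
# `BalabanUV.Beta.FP.FFPerturbationCarrier` — road «FP» for binder row D1, row **N2a-ENG v2** (owner d1-p3, `N2B-DESIGN.md` v1.3 §7, journal l.32289;
# OWNER WORD l.32887 «`D m = D_E m` ENTIRELY: the step defect of road FP is carried by the ff-line defect `E♭_m` alone»): THE GENERIC HALF OF THE `D_E` WORD LIST,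
# CARRIER SIDE — an ff-SUPPORTED perturbation `E` of a packed resolvent `A` (every block of `E` touching a multiplier leg vanishes) is INVISIBLE to every
# column object (`colH`, `colM`, `vertexOfK`, `vertexOfM`, `dM`, `vertex2OfK`, `mixOfK`) and enters an1's second-order carrier `W2OfK` ONLY through the
# sandwich `K2OfK = −A∘dM∘A`, by EXACTLY three words: `W2OfK (A + E) = W2OfK A − dM (A∘D∘E + E∘D∘A + E∘D∘E)` with `D := dM A` (two single-`E`, one double-`E`)

HONEST DEPENDENCY (page 1, mandatory): continuum YM on T⁴ ⇐ BetaPertH ∧ nine spine estimates (0/9 proved); BetaPertH ⇐ (D1) ∧ (D4) ∧ CAP+tail;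
G-an2-4 gates asym, D1 and NE2/3/4.  HONEST FRAMING (cell contract, verbatim): «discharging `BetaPertH` makes Bałaban's UV stability UNCONDITIONAL —
a real constructive-QFT result; it is NOT the continuum limit and NOT the Clay problem.»  THIS MODULE is [folklore] multilinear algebra of absolutely
convergent lattice kernels over an1's `SecondOrderResponse` (`colM`, `vertexOfM`, `dM`, `K2OfK`, `vertex2OfK`, `mixOfK`, `W2OfK`), an4's
`OneStepKernelFamily.colH`∕`vertexOfK` and an2∕asym1's `ExpKernelCalculus`∕`KernelWard`∕`HessKerRate` summability letters BY NAME; GENERIC `d`, `N`, GENERIC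
kernels — NOTHING of the perfect objects is instantiated; no `def`, no `def … : Prop`, nothing cited, 0 sorry.  0∕4 row-D1 binders; NOT N2a (the generic half
of its word list only), NOT SDF, NOT D1, NOT BetaPertH, NOT continuum, NOT Clay.  «not in print; our bookkeeping».

ABSOLUTE RULE (cell charter, verbatim): «No internally-minted statement may enter as a cited fact. Every hypothesis is either kernel-proved in this
package or a verbatim quotation of a PUBLISHED theorem with page reference. The manuscript(s) under audit are NOT citable for their own disputed
steps — they are the thing under adjudication; programme-internal (2001/route/tribunal) claims are never citable.»

WHY (owner's N2a-ENG v2 shape + word l.32887).  In the BOTTOM split the `(m+1)`-fold perfect resolvent is `A_{m+1} = A₀ + E♭_m` with `A₀` the kernel whose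
ff block is `[A_1]_ff + T♭_m`, whose columns are the composed columns ((K-fm) `kPerf_column_semigroup`, (K-mm) `PerfectMultiplierBlockLift`) and `E♭_m` the
BOTTOM gauge defect (`PerfectGaugeDefectBottom`) — an ff-SUPPORTED kernel.  `D_E m` := the words of `hessKer A_{m+1} V_{m+1} W_{m+1}` with at least one
`E♭_m` line.  Since the vertices read `A` only through its COLUMNS, `V_{m+1}` carries NO `E`-word and `W_{m+1} = W2SymOfK A_{m+1} …` carries `E`-words ONLY
through the `dM (K2OfK A_{m+1} …)` summand — this file proves exactly that, for GENERIC `A`, `E`, tables, and lists the three sandwich words; the `A`-slot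
words of `hessKer` itself (tadpole 1, bubble 2+1) are the companion file `FP/FFPerturbationHessWords`.

CONTENT (generic `d`, `N`; `E` ff-supported means (fm) `E x y (inl κ) (inr μ) = 0` and (mm) `E x y (inr ρ) (inr μ) = 0` — DISPLAYED letters):
* §1 (no analysis): `colH_add_of_fm`, `colM_add_of_mm`, `vertexOfK_add_of_fm`, `vertexOfM_add_of_mm`, **`dM_add_of_fm_mm`**, `vertex2OfK_add_of_fm`,
  `mixOfK_add_of_fm_mm`, **`K2OfK_add_of_fm_mm`** (`K2OfK (A+E) = −(A+E)∘(dM A)∘(A+E)`), **`W2OfK_add_of_fm_mm`** (`W2OfK (A+E) = vertex2OfK A + mixOfK A + mixOfK A↔ +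
  dM (K2OfK (A+E)) …`).
* §2 (summability bookkeeping): `comp_add_left` (the twin of an2's `StepJetData.comp_add_right`, slice-summable), `bdd_add`, **`sandwich_add_words`** (decaying `A`, `E`, bi-localised `Dk`:
  `(A+E)∘Dk∘(A+E) = A∘Dk∘A + (A∘Dk∘E + E∘Dk∘A + E∘Dk∘E)`), **`K2OfK_add_words`** (`K2OfK (A+E) … ν y′ = K2OfK A … ν y′ − W₃` pointwise, `W₃` the three words with `Dk := dM A N S M ν y′`).
* §3 (the kernel slot of `dM` is additive for bi-localised kernels and bounded tables): `summable_colH_mul`, `summable_colM_mul`, `vertexOfK_add_kernel`, `vertexOfM_add_kernel`,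
  **`dM_add_kernel`**, `dM_neg_kernel`, **`dM_sub_kernel`**.
Provenance: D1 formalisation swarm LEAF PROVER 06, unit b2b-balaban-beta-d1-formalise-leaf-06 gen 14 (prover-b2b-balaban-beta-d1-formalise-leaf-06-g14-0), 2026-08-21
(journal INTENT 3 l.32955; leaf-01 g16 co-first-refusal GO + precision P-d1leaf01g16-1 l.33023 — under `dM` only the word `E∘D∘A` survives,
their add-on `FP/FFPerturbationSandwichNull`); no existing file touched.
-/

noncomputable section

namespace Summit.QuantumFields.BalabanUV.Beta.FP.FFPerturbationCarrier

open Literature.MathematicalPhysics.QuantumFieldTheory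
open Literature.MathematicalPhysics.QuantumFieldTheory.Balaban1983to89
open Literature.MathematicalPhysics.QuantumFieldTheory.Balaban1983to89.Beta
open B12Sec2to5 (l1 l1_nonneg)
open ExpKernelCalculus (MKer comp Decays BiLoc biLoc_comp_decays summable_exp_shift')
open LatticeForm (quo)
open OneStepResolventKernel (Fib wsum quo_zsmul)
open OneStepKernelFamily (colH vertexOfK)
open KernelWard (Bdd bdd_of_decays bdd_of_biLoc slices_bdd_biLoc slices_biLoc_bdd biLoc_add)
open BalabanStepJetsSucc (biLoc_comp_right)
open StepJetData (comp_add_right)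
open InterLevelTransport (cwsum cwsum_apply)
open SecondOrderResponse (colM vertexOfM dM K2OfK vertex2OfK mixOfK W2OfK abs_colH_le_of_biLoc abs_colM_le_of_biLoc biLoc_neg)

variable {d : ℕ} {N : ℕ}

/-! ## §1 An ff-supported perturbation is invisible to the columns -/

section Columns

variable {A E : MKer (d + 1) (Fib d)}

/-- [folklore] An `(inl, inr)`-vanishing perturbation does not change the `ℋ`-columns. -/
theorem colH_add_of_fm (hfm : ∀ x y (κ μ : Fin (d + 1)), E x y (Sum.inl κ) (Sum.inr μ) = 0) (μ : Fin (d + 1)) (y : Fin (d + 1) → ℤ)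
    (κ' : Fin (d + 1)) : colH (A + E) N μ y κ' = colH A N μ y κ' := by
  funext u
  simp only [colH, Pi.add_apply, hfm, add_zero]

/-- [folklore] An `(inr, inr)`-vanishing perturbation does not change the multiplier columns. -/
theorem colM_add_of_mm (hmm : ∀ x y (ρ μ : Fin (d + 1)), E x y (Sum.inr ρ) (Sum.inr μ) = 0) (μ : Fin (d + 1)) (y : Fin (d + 1) → ℤ)
    (ρ : Fin (d + 1)) : colM (A + E) N μ y ρ = colM A N μ y ρ := by
  funext w
  simp only [colM, Pi.add_apply, hmm, add_zero]

/-- [folklore] … nor the chain-rule vertex through the `ℋ`-columns. -/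
theorem vertexOfK_add_of_fm (hfm : ∀ x y (κ μ : Fin (d + 1)), E x y (Sum.inl κ) (Sum.inr μ) = 0)
    (S : Fin (d + 1) → (Fin (d + 1) → ℤ) → MKer (d + 1) (Fib d)) (μ : Fin (d + 1)) (y : Fin (d + 1) → ℤ) :
    vertexOfK (A + E) N S μ y = vertexOfK A N S μ y := by
  funext x z a b
  simp only [vertexOfK, colH_add_of_fm hfm]

/-- [folklore] … nor the multiplier-column vertex. -/
theorem vertexOfM_add_of_mm (hmm : ∀ x y (ρ μ : Fin (d + 1)), E x y (Sum.inr ρ) (Sum.inr μ) = 0)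
    (M : Fin (d + 1) → (Fin (d + 1) → ℤ) → MKer (d + 1) (Fib d)) (μ : Fin (d + 1)) (y : Fin (d + 1) → ℤ) :
    vertexOfM (A + E) N M μ y = vertexOfM A N M μ y := by
  funext x z a b
  simp only [vertexOfM, colM_add_of_mm hmm]

/-- [folklore] **THE BACKGROUND DERIVATIVE OF THE OPERATOR IS BLIND TO AN ff-SUPPORTED PERTURBATION OF THE RESOLVENT**: `dM (A + E) N S M = dM A N S M`. -/
theorem dM_add_of_fm_mm (hfm : ∀ x y (κ μ : Fin (d + 1)), E x y (Sum.inl κ) (Sum.inr μ) = 0)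
    (hmm : ∀ x y (ρ μ : Fin (d + 1)), E x y (Sum.inr ρ) (Sum.inr μ) = 0)
    (S M : Fin (d + 1) → (Fin (d + 1) → ℤ) → MKer (d + 1) (Fib d)) (μ : Fin (d + 1)) (y : Fin (d + 1) → ℤ) :
    dM (A + E) N S M μ y = dM A N S M μ y := by
  unfold dM
  rw [vertexOfK_add_of_fm hfm, vertexOfM_add_of_mm hmm]

/-- [folklore] … the bi-vertex is blind too. -/
theorem vertex2OfK_add_of_fm (hfm : ∀ x y (κ μ : Fin (d + 1)), E x y (Sum.inl κ) (Sum.inr μ) = 0)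
    (S₂ : Fin (d + 1) → (Fin (d + 1) → ℤ) → Fin (d + 1) → (Fin (d + 1) → ℤ) → MKer (d + 1) (Fib d))
    (μ : Fin (d + 1)) (y : Fin (d + 1) → ℤ) (ν : Fin (d + 1)) (y' : Fin (d + 1) → ℤ) :
    vertex2OfK (A + E) N S₂ μ y ν y' = vertex2OfK A N S₂ μ y ν y' := by
  unfold vertex2OfK
  have h : (fun κ u => vertexOfK (A + E) N (S₂ κ u) ν y') = fun κ u => vertexOfK A N (S₂ κ u) ν y' :=
    funext fun κ => funext fun u => vertexOfK_add_of_fm hfm _ ν y'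
  rw [h, vertexOfK_add_of_fm hfm]

/-- [folklore] … and the mixed bi-vertex. -/
theorem mixOfK_add_of_fm_mm (hfm : ∀ x y (κ μ : Fin (d + 1)), E x y (Sum.inl κ) (Sum.inr μ) = 0)
    (hmm : ∀ x y (ρ μ : Fin (d + 1)), E x y (Sum.inr ρ) (Sum.inr μ) = 0)
    (M₂ : Fin (d + 1) → (Fin (d + 1) → ℤ) → Fin (d + 1) → (Fin (d + 1) → ℤ) → MKer (d + 1) (Fib d))
    (μ : Fin (d + 1)) (y : Fin (d + 1) → ℤ) (ν : Fin (d + 1)) (y' : Fin (d + 1) → ℤ) :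
    mixOfK (A + E) N M₂ μ y ν y' = mixOfK A N M₂ μ y ν y' := by
  unfold mixOfK
  have h : (fun κ u => vertexOfM (A + E) N (M₂ κ u) ν y') = fun κ u => vertexOfM A N (M₂ κ u) ν y' :=
    funext fun κ => funext fun u => vertexOfM_add_of_mm hmm _ ν y'
  rw [h, vertexOfK_add_of_fm hfm]

/-- [folklore] **THE SANDWICH WITH AN ff-SUPPORTED PERTURBATION**: `K2OfK (A + E) N S M ν y′ = −(A + E) ∘ (dM A N S M ν y′) ∘ (A + E)` — the inner derivative is
`E`-free (`dM_add_of_fm_mm`); `E` survives only in the two outer factors. -/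
theorem K2OfK_add_of_fm_mm (hfm : ∀ x y (κ μ : Fin (d + 1)), E x y (Sum.inl κ) (Sum.inr μ) = 0)
    (hmm : ∀ x y (ρ μ : Fin (d + 1)), E x y (Sum.inr ρ) (Sum.inr μ) = 0)
    (S M : Fin (d + 1) → (Fin (d + 1) → ℤ) → MKer (d + 1) (Fib d)) (ν : Fin (d + 1)) (y' : Fin (d + 1) → ℤ) :
    K2OfK (A + E) N S M ν y' = fun x z a b => -(comp (comp (A + E) (dM A N S M ν y')) (A + E) x z a b) := by
  unfold K2OfK
  rw [dM_add_of_fm_mm hfm hmm]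

/-- [folklore] **THE SECOND-ORDER CARRIER SEES AN ff-SUPPORTED PERTURBATION ONLY THROUGH THE SANDWICH**:
`W2OfK (A + E) … μ y ν y′ = vertex2OfK A … + mixOfK A … μ y ν y′ + mixOfK A … ν y′ μ y + dM (K2OfK (A + E) N S M ν y′) N S M μ y`. -/
theorem W2OfK_add_of_fm_mm (hfm : ∀ x y (κ μ : Fin (d + 1)), E x y (Sum.inl κ) (Sum.inr μ) = 0)
    (hmm : ∀ x y (ρ μ : Fin (d + 1)), E x y (Sum.inr ρ) (Sum.inr μ) = 0)
    (S M : Fin (d + 1) → (Fin (d + 1) → ℤ) → MKer (d + 1) (Fib d))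
    (S₂ M₂ : Fin (d + 1) → (Fin (d + 1) → ℤ) → Fin (d + 1) → (Fin (d + 1) → ℤ) → MKer (d + 1) (Fib d))
    (μ : Fin (d + 1)) (y : Fin (d + 1) → ℤ) (ν : Fin (d + 1)) (y' : Fin (d + 1) → ℤ) :
    W2OfK (A + E) N S M S₂ M₂ μ y ν y'
      = vertex2OfK A N S₂ μ y ν y' + mixOfK A N M₂ μ y ν y' + mixOfK A N M₂ ν y' μ y + dM (K2OfK (A + E) N S M ν y') N S M μ y := by
  unfold W2OfK
  rw [vertex2OfK_add_of_fm hfm, mixOfK_add_of_fm_mm hfm hmm, mixOfK_add_of_fm_mm hfm hmm]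

end Columns

/-! ## §2 The sandwich words -/

section Sandwich

variable {D : ℕ} {F : Type*} [Fintype F]

/-- [folklore] `(K + L) ∘ M = K ∘ M + L ∘ M` (given slice summability). -/
theorem comp_add_left {K L M : ExpKernelCalculus.MKer D F}
    (hK : ∀ x z a b, Summable fun y : Fin D → ℤ => ∑ f, K x y a f * M y z f b)
    (hL : ∀ x z a b, Summable fun y : Fin D → ℤ => ∑ f, L x y a f * M y z f b) :
    comp (K + L) M = comp K M + comp L M := by
  funext x z a b
  show (∑' y, ∑ f, (K + L) x y a f * M y z f b) = (∑' y, ∑ f, K x y a f * M y z f b) + ∑' y, ∑ f, L x y a f * M y z f b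
  rw [← (hK x z a b).tsum_add (hL x z a b)]
  refine tsum_congr fun y => ?_
  rw [← Finset.sum_add_distrib]
  refine Finset.sum_congr rfl fun f _ => ?_
  simp only [Pi.add_apply]
  ring

omit [Fintype F] in
/-- [folklore] Bounded + bounded is bounded. -/
theorem bdd_add {K L : ExpKernelCalculus.MKer D F} {B B' : ℝ} (hK : Bdd K B) (hL : Bdd L B') : Bdd (K + L) (B + B') :=
  fun x y a b => (abs_add_le _ _).trans (add_le_add (hK x y a b) (hL x y a b))

/-- [folklore] **THE SANDWICH WORDS**: for decaying `A`, `E` and a kernel `Dk` bi-localised at `(p, p)` (all at rate `δ > 0`),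
`(A + E) ∘ Dk ∘ (A + E) = A ∘ Dk ∘ A + (A ∘ Dk ∘ E + E ∘ Dk ∘ A + E ∘ Dk ∘ E)` — two single-`E` words and the double-`E` word, all series absolutely convergent. -/
theorem sandwich_add_words {A E Dk : ExpKernelCalculus.MKer D F} {C CE Cd δ : ℝ} {p : Fin D → ℤ} (hA : Decays A C δ) (hE : Decays E CE δ)
    (hD : BiLoc Dk p p Cd δ) (hδ : 0 < δ) :
    comp (comp (A + E) Dk) (A + E)
      = comp (comp A Dk) A + (comp (comp A Dk) E + comp (comp E Dk) A + comp (comp E Dk) E) := by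
  have hδ2 : 0 < δ / 2 := by linarith
  have hAb : Bdd A C := bdd_of_decays hA hδ.le
  have hEb : Bdd E CE := bdd_of_decays hE hδ.le
  have hAD := biLoc_comp_decays hA hD hδ2.le (by linarith : δ / 2 < δ)
  have hED := biLoc_comp_decays hE hD hδ2.le (by linarith : δ / 2 < δ)
  rw [comp_add_left (slices_bdd_biLoc hAb hD hδ) (slices_bdd_biLoc hEb hD hδ),
    comp_add_left (slices_biLoc_bdd hAD (bdd_add hAb hEb) hδ2) (slices_biLoc_bdd hED (bdd_add hAb hEb) hδ2),
    comp_add_right (slices_biLoc_bdd hAD hAb hδ2) (slices_biLoc_bdd hAD hEb hδ2),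
    comp_add_right (slices_biLoc_bdd hED hAb hδ2) (slices_biLoc_bdd hED hEb hδ2)]
  abel

end Sandwich

section SandwichK2

variable {A E : MKer (d + 1) (Fib d)} {C CE Cd δ : ℝ}

/-- [folklore] **`K2OfK` OF THE PERTURBED RESOLVENT, AS WORDS**: with `Dk := dM A N S M ν y′` (bi-localised at `(p, p)`, e.g. `p = N•y′` by an1's `vertexFamily_dM`),
`K2OfK (A + E) N S M ν y′ = K2OfK A N S M ν y′ − (A∘Dk∘E + E∘Dk∘A + E∘Dk∘E)` pointwise (ff-supported `E`; decaying `A`, `E`). -/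
theorem K2OfK_add_words (hfm : ∀ x y (κ μ : Fin (d + 1)), E x y (Sum.inl κ) (Sum.inr μ) = 0)
    (hmm : ∀ x y (ρ μ : Fin (d + 1)), E x y (Sum.inr ρ) (Sum.inr μ) = 0)
    (S M : Fin (d + 1) → (Fin (d + 1) → ℤ) → MKer (d + 1) (Fib d)) (ν : Fin (d + 1)) (y' : Fin (d + 1) → ℤ) {p : Fin (d + 1) → ℤ}
    (hA : Decays A C δ) (hE : Decays E CE δ) (hD : BiLoc (dM A N S M ν y') p p Cd δ) (hδ : 0 < δ) :
    K2OfK (A + E) N S M ν y'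
      = K2OfK A N S M ν y' - (comp (comp A (dM A N S M ν y')) E + comp (comp E (dM A N S M ν y')) A + comp (comp E (dM A N S M ν y')) E) := by
  rw [K2OfK_add_of_fm_mm hfm hmm S M ν y', sandwich_add_words hA hE hD hδ]
  funext x z a b
  simp only [K2OfK, Pi.sub_apply, Pi.add_apply]
  ring

end SandwichK2

/-! ## §3 The kernel slot of `dM` is additive (bi-localised kernels, bounded tables) -/

section KernelSlot

variable {K₁ K₂ : MKer (d + 1) (Fib d)} {q : Fin (d + 1) → ℤ} {C₁ C₂ m B B' : ℝ}

/-- [folklore] The `ℋ`-column of a bi-localised kernel against a bounded stencil member is summable in the fine leg. -/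
theorem summable_colH_mul {K : MKer (d + 1) (Fib d)} {C : ℝ} (hK : BiLoc K q q C m) (hm : 0 < m)
    {T : (Fin (d + 1) → ℤ) → MKer (d + 1) (Fib d)} (hT : ∀ u x z a b, |T u x z a b| ≤ B) (μ : Fin (d + 1)) (y : Fin (d + 1) → ℤ) (κ' : Fin (d + 1))
    (x z : Fin (d + 1) → ℤ) (a b : Fib d) :
    Summable fun u => colH K N μ y κ' u * T u x z a b := by
  have hB : 0 ≤ B := (abs_nonneg _).trans (hT 0 x z a b)
  refine Summable.of_norm_bounded ((summable_exp_shift' hm q).mul_left (C * Real.exp (-m * l1 ((N : ℤ) • y - q)) * B)) (fun u => ?_)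
  rw [Real.norm_eq_abs, abs_mul]
  have h1 := abs_colH_le_of_biLoc (N := N) hK μ y κ' u
  have hC : 0 ≤ C * Real.exp (-m * l1 ((N : ℤ) • y - q)) * Real.exp (-m * l1 (u - q)) := (abs_nonneg _).trans h1
  calc |colH K N μ y κ' u| * |T u x z a b| ≤ (C * Real.exp (-m * l1 ((N : ℤ) • y - q)) * Real.exp (-m * l1 (u - q))) * B :=
        mul_le_mul h1 (hT u x z a b) (abs_nonneg _) hC
    _ = C * Real.exp (-m * l1 ((N : ℤ) • y - q)) * B * Real.exp (-m * l1 (u - q)) := by ring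

/-- [folklore] The multiplier column of a bi-localised kernel against a bounded coarse-indexed table member is summable in the coarse leg. -/
theorem summable_colM_mul [NeZero N] {K : MKer (d + 1) (Fib d)} {C : ℝ} (hK : BiLoc K q q C m) (hm : 0 < m)
    {T : (Fin (d + 1) → ℤ) → MKer (d + 1) (Fib d)} (hT : ∀ w x z a b, |T w x z a b| ≤ B) (μ : Fin (d + 1)) (y : Fin (d + 1) → ℤ) (ρ : Fin (d + 1))
    (x z : Fin (d + 1) → ℤ) (a b : Fib d) :
    Summable fun w => colM K N μ y ρ w * T w x z a b := by
  have hinj : Function.Injective (fun w : Fin (d + 1) → ℤ => (N : ℤ) • w) := by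
    intro w w' h
    have := congrArg (quo N) h
    simpa only [quo_zsmul] using this
  have hs : Summable fun w : Fin (d + 1) → ℤ => Real.exp (-m * l1 ((N : ℤ) • w - q)) :=
    (summable_exp_shift' hm q).comp_injective hinj
  refine Summable.of_norm_bounded (hs.mul_left (C * Real.exp (-m * l1 ((N : ℤ) • y - q)) * B)) (fun w => ?_)
  rw [Real.norm_eq_abs, abs_mul]
  have h1 := abs_colM_le_of_biLoc (N := N) hK μ y ρ w
  have hC : 0 ≤ C * Real.exp (-m * l1 ((N : ℤ) • y - q)) * Real.exp (-m * l1 ((N : ℤ) • w - q)) := (abs_nonneg _).trans h1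
  calc |colM K N μ y ρ w| * |T w x z a b| ≤ (C * Real.exp (-m * l1 ((N : ℤ) • y - q)) * Real.exp (-m * l1 ((N : ℤ) • w - q))) * B :=
        mul_le_mul h1 (hT w x z a b) (abs_nonneg _) hC
    _ = C * Real.exp (-m * l1 ((N : ℤ) • y - q)) * B * Real.exp (-m * l1 ((N : ℤ) • w - q)) := by ring

/-- [folklore] **THE CHAIN-RULE VERTEX IS ADDITIVE IN THE KERNEL SLOT** (kernels bi-localised at `(q, q)`, stencil bounded):
`vertexOfK (K₁ + K₂) N S μ y = vertexOfK K₁ N S μ y + vertexOfK K₂ N S μ y`. -/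
theorem vertexOfK_add_kernel (h₁ : BiLoc K₁ q q C₁ m) (h₂ : BiLoc K₂ q q C₂ m) (hm : 0 < m)
    {S : Fin (d + 1) → (Fin (d + 1) → ℤ) → MKer (d + 1) (Fib d)} (hS : ∀ κ u x z a b, |S κ u x z a b| ≤ B) (μ : Fin (d + 1)) (y : Fin (d + 1) → ℤ) :
    vertexOfK (K₁ + K₂) N S μ y = vertexOfK K₁ N S μ y + vertexOfK K₂ N S μ y := by
  funext x z a b
  simp only [vertexOfK, wsum, Pi.add_apply, ← Finset.sum_add_distrib]
  refine Finset.sum_congr rfl fun κ' _ => ?_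
  rw [← (summable_colH_mul h₁ hm (hS κ') μ y κ' x z a b).tsum_add (summable_colH_mul h₂ hm (hS κ') μ y κ' x z a b)]
  refine tsum_congr fun u => ?_
  simp only [colH, Pi.add_apply]
  ring

/-- [folklore] **THE MULTIPLIER-COLUMN VERTEX IS ADDITIVE IN THE KERNEL SLOT** (same letters). -/
theorem vertexOfM_add_kernel [NeZero N] (h₁ : BiLoc K₁ q q C₁ m) (h₂ : BiLoc K₂ q q C₂ m) (hm : 0 < m)
    {M : Fin (d + 1) → (Fin (d + 1) → ℤ) → MKer (d + 1) (Fib d)} (hM : ∀ ρ w x z a b, |M ρ w x z a b| ≤ B) (μ : Fin (d + 1)) (y : Fin (d + 1) → ℤ) :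
    vertexOfM (K₁ + K₂) N M μ y = vertexOfM K₁ N M μ y + vertexOfM K₂ N M μ y := by
  funext x z a b
  simp only [vertexOfM, Pi.add_apply, ← Finset.sum_add_distrib]
  refine Finset.sum_congr rfl fun ρ _ => ?_
  rw [cwsum_apply, cwsum_apply, cwsum_apply,
    ← (summable_colM_mul h₁ hm (hM ρ) μ y ρ x z a b).tsum_add (summable_colM_mul h₂ hm (hM ρ) μ y ρ x z a b)]
  refine tsum_congr fun w => ?_
  simp only [colM, Pi.add_apply]
  ring

/-- [folklore] **`dM` IS ADDITIVE IN THE KERNEL SLOT**: `dM (K₁ + K₂) N S M μ y = dM K₁ N S M μ y + dM K₂ N S M μ y`. -/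
theorem dM_add_kernel [NeZero N] (h₁ : BiLoc K₁ q q C₁ m) (h₂ : BiLoc K₂ q q C₂ m) (hm : 0 < m)
    {S M : Fin (d + 1) → (Fin (d + 1) → ℤ) → MKer (d + 1) (Fib d)} (hS : ∀ κ u x z a b, |S κ u x z a b| ≤ B) (hM : ∀ ρ w x z a b, |M ρ w x z a b| ≤ B')
    (μ : Fin (d + 1)) (y : Fin (d + 1) → ℤ) :
    dM (K₁ + K₂) N S M μ y = dM K₁ N S M μ y + dM K₂ N S M μ y := by
  unfold dM
  rw [vertexOfK_add_kernel h₁ h₂ hm hS, vertexOfM_add_kernel h₁ h₂ hm hM]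
  abel

/-- [folklore] A bi-localised kernel's negative is bi-localised (the `Pi`-negation form of an1's `biLoc_neg`). -/
theorem biLoc_neg_pi {K : MKer (d + 1) (Fib d)} {C : ℝ} (h : BiLoc K q q C m) : BiLoc (-K) q q C m := by
  intro x z a b
  rw [Pi.neg_apply, Pi.neg_apply, Pi.neg_apply, Pi.neg_apply, abs_neg]
  exact h x z a b

/-- [folklore] `dM` of the negated kernel (no letters needed beyond `N ≠ 0`). -/
theorem dM_neg_kernel [NeZero N] (K : MKer (d + 1) (Fib d)) (S M : Fin (d + 1) → (Fin (d + 1) → ℤ) → MKer (d + 1) (Fib d)) (μ : Fin (d + 1))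
    (y : Fin (d + 1) → ℤ) : dM (-K) N S M μ y = -dM K N S M μ y := by
  funext x z a b
  simp only [dM, vertexOfK, vertexOfM, wsum, cwsum_apply, colH, colM, Pi.add_apply, Pi.neg_apply, neg_mul, tsum_neg,
    Finset.sum_neg_distrib, neg_add]

/-- [folklore] **`dM` IS SUBTRACTIVE IN THE KERNEL SLOT**: `dM (K₁ − K₂) N S M μ y = dM K₁ N S M μ y − dM K₂ N S M μ y`. -/
theorem dM_sub_kernel [NeZero N] (h₁ : BiLoc K₁ q q C₁ m) (h₂ : BiLoc K₂ q q C₂ m) (hm : 0 < m)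
    {S M : Fin (d + 1) → (Fin (d + 1) → ℤ) → MKer (d + 1) (Fib d)} (hS : ∀ κ u x z a b, |S κ u x z a b| ≤ B) (hM : ∀ ρ w x z a b, |M ρ w x z a b| ≤ B')
    (μ : Fin (d + 1)) (y : Fin (d + 1) → ℤ) :
    dM (K₁ - K₂) N S M μ y = dM K₁ N S M μ y - dM K₂ N S M μ y := by
  rw [sub_eq_add_neg, dM_add_kernel h₁ (biLoc_neg_pi h₂) hm hS hM, dM_neg_kernel, ← sub_eq_add_neg]

end KernelSlot

end Summit.QuantumFields.BalabanUV.Beta.FP.FFPerturbationCarrier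

end
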